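import Summits.ResolutionOfSingularities.ResolutionOfSingularities.Theorems.EquisingularLiftEquisingularLiftNatSpecimenSteinerNu2
import Summits.ResolutionOfSingularities.ResolutionOfSingularities.Theorems.EquisingularLiftEquisingularLiftNatSpecimenSkewLinesLiftableNoseClass
import Summits.ResolutionOfSingularities.ResolutionOfSingularities.Theorems.EquisingularLiftEquisingularLiftNatNoseResidueClassTwoRegular
import Summits.ResolutionOfSingularities.ResolutionOfSingularities.Theorems.EquisingularLiftEquisingularLiftNatNoseResidueStrictTransformCurve
import Summits.ResolutionOfSingularities.ResolutionOfSingularities.Theorems.EquisingularLiftEquisingularLiftNatStrictTransformCentre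
import Summits.ResolutionOfSingularities.ResolutionOfSingularities.Theorems.EquisingularLiftEquisingularLiftNatVertexLineDisjoint
import Summits.ResolutionOfSingularities.ResolutionOfSingularities.Theorems.EquisingularLiftEquisingularLiftNatNoseUnionCurveClause
import Summits.ResolutionOfSingularities.ResolutionOfSingularities.Theorems.EquisingularLiftEquisingularLiftNatNDRangeSubscheme
import Literature.AlgebraicGeometry.Resolution.MvPolynomialKillVars
import Literature.AlgebraicGeometry.Resolution.PermissibleCentres
import Literature.AlgebraicGeometry.Resolution.Lemma411DivisorPoints
import Literature.AlgebraicGeometry.Resolution.BlowupReducedDimension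
import Literature.AlgebraicGeometry.Resolution.BlowupsIntegral
import Literature.AlgebraicGeometry.Resolution.MarkedIdeals
import Literature.AlgebraicGeometry.Resolution.ResolutionOfComponentsRegularLocus
import Summits.ResolutionOfSingularities.ResolutionOfSingularities.Theorems.EquisingularLiftEquisingularLiftReducedStrictTransformBlowup
import HarnessLib

/-!
# [OURS · L1 W4.5(b) · EL♮(3) · NOSE, N-2 brick (C), part 2] STEINER — clause (b): the nose `Z̃′` (three disjoint strict-transform lines) is a REGULAR
# CURVE; «Steiner ∈ ν2» modulo (c) `DirStepUnobs` and (d) the final regularity only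

res-L1-w45b-nose-w2 g2 (WIDTH seat on D-0157 DOOR 1, nose row; desk GO «N-2»). OURS; NOT a statement of any manuscript ([Hironaka2017] is a candidate
under adjudication, nothing of it is asserted); AI-written, weaker than expert review. No `sorry`; standard axioms; DEF-FREE (standing `local instance`
attribute of the specimen files). `--kind proof --supports stmt-ResolutionOfSingularities-20148 --as helper`; closes nothing. Resolution of singularities in
positive characteristic is NOT proved here or anywhere in this chain (dimension 3 is Cossart–Piltant 2008/2009 in print); EL♮(3) is NOT proved by this file.

WHAT (continuing ✓ `…NatSpecimenSteinerNu2`, whose `noseHypPointsFirstBTriplePrime_of_clauses'` is «Steiner ∈ ν2» modulo (b)(c)(d)): CLAUSE (b).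
§1 `isRegular_subscheme_of_reducedPoint` / `isRegular_comap_vanishingIdeal_singleton` — closed subschemes of a reduced closed point are regular, so
`V(𝓘{x}·𝒪_D)` is regular for every closed immersion `D ↪ X` (COMB C1's `hDC` for POINT centres). §2 the lines `Lᵢ = vertexLine 2 k i`: `L̃ᵢ` regular
(pv-022 `SkewLines.line_isLiftableNoseClass` + nose-w4 ✓ `isRegular_redSub_of_isLiftableNoseClass₂`), irreducible (generic point `(x_j : j ≠ i, 3)`), infinite,
`dim = 1` and the curve clause (nose-w4 bricks 2/6 on the non-regular integral `S ⊇ Lᵢ`). §3 per line `Zᵢ′ = vertexLineStrict υ i = closure υ⁻¹(Lᵢ ∖ V(𝓘{P}))`: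
`Z̃ᵢ′` REGULAR (COMB C1) and a CURVE (Stacks 080E: `Z̃ᵢ′ → L̃ᵢ` a blow-up along the non-zero `𝓘{P}·𝒪`, proper birational, `dim ≤ 1`; nose-w4 ✓
`strictTransform_singularCurve_noseData`). §4 the union over nose-w3's ✓ `disjoint_vertexLineStrict`: `Z̃′` regular and a curve; ★
`noseHypPointsFirstBTriplePrime_of_unobs_of_final` = «Steiner ∈ ν2» MODULO (c) `DirStepUnobs` and (d) the final regularity ONLY.
-/

set_option linter.dupNamespace false -- mandated namespace `Summit.<Summit>.<Problem>` of this single-conjunct summit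

noncomputable section

open CategoryTheory CategoryTheory.Limits AlgebraicGeometry TopologicalSpace IsLocalRing
open MvPolynomial
open Literature.AlgebraicGeometry.Resolution Literature.AlgebraicGeometry.Resolution.DeJong1996
open Literature.AlgebraicGeometry.Motives Literature.AlgebraicGeometry.Motives.SmoothHypersurface
open Literature.AlgebraicGeometry.Motives.ProjectiveSpace
open AlgebraicGeometry.Scheme.IdealSheafData
open Summit.ResolutionOfSingularities.ResolutionOfSingularities.Theorems.EquisingularLift

attribute [local instance] MvPolynomial.gradedAlgebra ProjBaseChange.algebraBase

namespace Summit.ResolutionOfSingularities.ResolutionOfSingularities.Cruxes.EquisingularLiftNat.Sections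

/-! ## §1 Closed subschemes of a reduced closed point are regular -/

/-- **Every closed subscheme of the reduced closed point `{x}~` of a locally Noetherian scheme is regular**: the only stalk of `{x}~` is the residue
field `𝒪_{X,x}/𝔪_x` (`stalkIdeal_vanishingIdeal_singleton`), and a quotient of a field by a proper ideal is that field. [folklore] -/
theorem isRegular_subscheme_of_reducedPoint {X : Scheme.{0}} [IsLocallyNoetherian X] {x : X} (hx : IsClosed ({x} : Set X))
    (J : ((vanishingIdeal (⟨{x}, hx⟩ : Closeds X)).subscheme).IdealSheafData) : Scheme.IsRegular J.subscheme := by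
  haveI : IsLocallyNoetherian (vanishingIdeal (⟨{x}, hx⟩ : Closeds X)).subscheme :=
    LocallyOfFiniteType.isLocallyNoetherian (vanishingIdeal (⟨{x}, hx⟩ : Closeds X)).subschemeι
  refine Scheme.isRegular_subscheme_of_forall J fun y hy => ?_
  -- the point `y` lies over `x`, and its stalk is the residue field
  have hyx : (vanishingIdeal (⟨{x}, hx⟩ : Closeds X)).subschemeι y = x := by
    have h : (vanishingIdeal (⟨{x}, hx⟩ : Closeds X)).subschemeι y ∈ ((vanishingIdeal (⟨{x}, hx⟩ : Closeds X)).support : Set X) := by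
      rw [← range_subschemeι]; exact Set.mem_range_self y
    rw [Scheme.IdealSheafData.coe_support_vanishingIdeal] at h
    exact h
  obtain ⟨e⟩ := nonempty_quotientStalkIdealEquiv hx y hyx
  rw [stalkIdeal_vanishingIdeal_singleton hx] at e
  letI : Field (X.presheaf.stalk x ⧸ maximalIdeal (X.presheaf.stalk x)) := Ideal.Quotient.field _
  have hF : IsField (((vanishingIdeal (⟨{x}, hx⟩ : Closeds X)).subscheme).presheaf.stalk y) :=
    MulEquiv.isField (Field.toIsField _) e.symm.toMulEquiv
  letI := hF.toField
  -- a proper ideal of a field is `⊥`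
  have hne : stalkIdeal J y ≠ ⊤ := by
    intro h
    have hle := (mem_support_iff_stalkIdeal_le J y).mp hy
    rw [h, top_le_iff] at hle
    exact (maximalIdeal.isMaximal _).ne_top hle
  have hbot : stalkIdeal J y = ⊥ := (Ideal.eq_bot_or_top (stalkIdeal J y)).resolve_right hne
  rw [hbot]
  exact IsRegularLocalRing.of_ringEquiv (RingEquiv.quotientBot _).symm

/-- **`V(𝓘{x}·𝒪_D)` is regular for every closed immersion `i : D ⟶ X`** (the scheme-theoretic intersection of `D` with the reduced point is a closed
subscheme of that point — symmetry `StrataSplit`/`CombCentre.isRegular_subscheme_comap_ker_symm` — hence regular by the previous lemma). This is COMB C1's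
`hDC` input for a POINT centre. [folklore] -/
theorem isRegular_comap_vanishingIdeal_singleton {X D : Scheme.{0}} [IsLocallyNoetherian X] {x : X} (hx : IsClosed ({x} : Set X))
    (i : D ⟶ X) [IsClosedImmersion i] :
    Scheme.IsRegular ((vanishingIdeal (⟨{x}, hx⟩ : Closeds X)).comap i).subscheme := by
  have hker : vanishingIdeal (⟨{x}, hx⟩ : Closeds X) = (vanishingIdeal (⟨{x}, hx⟩ : Closeds X)).subschemeι.ker := (ker_subschemeι _).symm
  rw [hker]
  exact Theorems.EquisingularLiftNat.CombCentre.isRegular_subscheme_comap_ker_symm i _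
    (isRegular_subscheme_of_reducedPoint hx _)

/-- Transport of regularity of reduced closed subschemes along an equality of the underlying closed sets. [folklore] -/
theorem isRegular_redSub_congr {X : Scheme.{0}} {Z₁ Z₂ : Set X} (h : Z₁ = Z₂) (h₁ : IsClosed Z₁) (h₂ : IsClosed Z₂) :
    Scheme.IsRegular (redSub X Z₁ h₁) ↔ Scheme.IsRegular (redSub X Z₂ h₂) := by subst h; exact Iff.rfl

/-- Transport of the curve clause along an equality of the underlying closed sets. [folklore] -/
theorem curveClause_redSub_congr {X : Scheme.{0}} {Z₁ Z₂ : Set X} (h : Z₁ = Z₂) (h₁ : IsClosed Z₁) (h₂ : IsClosed Z₂)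
    (H : ∀ z : ↥(redSub X Z₁ h₁), IsClosed ({z} : Set ↥(redSub X Z₁ h₁)) → ringKrullDim ((redSub X Z₁ h₁).presheaf.stalk z) = ((1 : ℕ) : WithBot ℕ∞)) :
    ∀ z : ↥(redSub X Z₂ h₂), IsClosed ({z} : Set ↥(redSub X Z₂ h₂)) → ringKrullDim ((redSub X Z₂ h₂).presheaf.stalk z) = ((1 : ℕ) : WithBot ℕ∞) := by
  subst h; exact H

namespace Steiner

variable (k : Type) [Field k]

/-! ## §2 The three lines through the triple point: regular, irreducible, infinite curves -/

/-- **`L̃ᵢ` is regular**: `vertexLine 2 k i` is the coordinate line `V₊(x_a, x_b)` (`{a, b} = {0,1,2} ∖ {i}`) of res-D-pv-022's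
`SkewLines.line_isLiftableNoseClass`, so its reduced subscheme is regular by res-L1-w45b-nose-w4's ✓ `isRegular_redSub_of_isLiftableNoseClass₂`.
[cite: Hartshorne1977, II Prop. 2.5 and I Ex. 2.17] -/
theorem isRegular_redSub_vertexLine (i : Fin 3) :
    Scheme.IsRegular (redSub (SpecimenQuarticTcDelta.P3 k) (vertexLine 2 k i) (isClosed_vertexLine i)) := by
  have key : ∀ (a b c : Fin (3 + 1)), a ≠ b → c ≠ a → c ≠ b →
      vertexLine 2 k i = {y : SpecimenQuarticTcDelta.P3 k | ∀ m : Fin 2,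
        (![X a, X b] : Fin 2 → MvPolynomial (Fin (3 + 1)) k) m ∈ y.asHomogeneousIdeal} →
      Scheme.IsRegular (redSub (SpecimenQuarticTcDelta.P3 k) (vertexLine 2 k i) (isClosed_vertexLine i)) := by
    intro a b c hab hca hcb heq
    have hcl : IsClosed {y : SpecimenQuarticTcDelta.P3 k | ∀ m : Fin 2,
        (![X a, X b] : Fin 2 → MvPolynomial (Fin (3 + 1)) k) m ∈ y.asHomogeneousIdeal} := heq ▸ isClosed_vertexLine i
    exact (isRegular_redSub_congr heq (isClosed_vertexLine i) hcl).mpr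
      (isRegular_redSub_of_isLiftableNoseClass₂ k 3 (IsLiftableNoseClass₂.base _ (SkewLines.line_isLiftableNoseClass k a b c hab hca hcb)) hcl)
  fin_cases i
  · refine key 1 2 0 (by decide) (by decide) (by decide) (Set.ext fun y => ?_)
    simp only [mem_vertexLine_iff, Set.mem_setOf_eq, Fin.forall_fin_two, Matrix.cons_val_zero, Matrix.cons_val_one]
    refine ⟨fun h => ⟨h 1 (by decide), h 2 (by decide)⟩, fun ⟨h1, h2⟩ j hj => ?_⟩
    fin_cases j <;> first | exact absurd rfl hj | exact h1 | exact h2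
  · refine key 0 2 1 (by decide) (by decide) (by decide) (Set.ext fun y => ?_)
    simp only [mem_vertexLine_iff, Set.mem_setOf_eq, Fin.forall_fin_two, Matrix.cons_val_zero, Matrix.cons_val_one]
    refine ⟨fun h => ⟨h 0 (by decide), h 2 (by decide)⟩, fun ⟨h1, h2⟩ j hj => ?_⟩
    fin_cases j <;> first | exact absurd rfl hj | exact h1 | exact h2
  · refine key 0 1 2 (by decide) (by decide) (by decide) (Set.ext fun y => ?_)
    simp only [mem_vertexLine_iff, Set.mem_setOf_eq, Fin.forall_fin_two, Matrix.cons_val_zero, Matrix.cons_val_one]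
    refine ⟨fun h => ⟨h 0 (by decide), h 1 (by decide)⟩, fun ⟨h1, h2⟩ j hj => ?_⟩
    fin_cases j <;> first | exact absurd rfl hj | exact h1 | exact h2

/-- **`Lᵢ` is irreducible**: it is the closure of its generic point, the homogeneous prime `(x_j : j ≤ 2, j ≠ i)` (prime since the quotient is a
polynomial ring, relevant since `x₃` survives). [cite: Hartshorne1977, II Ex. 2.9] -/
theorem isIrreducible_vertexLine (i : Fin 3) : IsIrreducible (vertexLine 2 k i) := by
  classical
  let T : Set (Fin (2 + 1 + 1)) := Fin.castSucc '' {j : Fin 3 | j ≠ i}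
  have hT3 : Fin.last 3 ∉ T := by
    rintro ⟨j, -, hj⟩
    exact (Fin.castSucc_lt_last j).ne hj
  let q : SpecimenQuarticTcDelta.P3 k :=
    { asHomogeneousIdeal := ⟨Ideal.span (MvPolynomial.X '' T),
        Ideal.homogeneous_span _ _ fun f hf => by
          obtain ⟨j, -, rfl⟩ := hf
          exact ⟨1, Segre.X_mem k j⟩⟩
      isPrime := (Ideal.Quotient.isDomain_iff_prime _).mp
        (Literature.AlgebraicGeometry.Resolution.MvPolynomial.isDomain_quotient_span_X (R := k) (s := T))
      not_irrelevant_le := fun h => Literature.AlgebraicGeometry.Resolution.MvPolynomial.X_not_mem_span_X (R := k) T hT3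
        (h (HomogeneousIdeal.mem_irrelevant_of_mem _ zero_lt_one (Segre.X_mem k (Fin.last 3)))) }
  have hzero : vertexLine 2 k i = ProjectiveSpectrum.zeroLocus (homogeneousSubmodule (Fin (3 + 1)) k) (MvPolynomial.X '' T) := by
    ext y
    constructor
    · intro h
      refine (ProjectiveSpectrum.mem_zeroLocus _ _ _).mpr ?_
      rintro _ ⟨_, ⟨j, hj, rfl⟩, rfl⟩
      exact h j hj
    · intro h j hj
      exact (ProjectiveSpectrum.mem_zeroLocus _ _ _).mp h ⟨Fin.castSucc j, ⟨j, hj, rfl⟩, rfl⟩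
  have hcl : vertexLine 2 k i = closure {q} := by
    rw [hzero]
    have h1 := ProjectiveSpectrum.zeroLocus_vanishingIdeal_eq_closure (𝒜 := homogeneousSubmodule (Fin (3 + 1)) k) ({q} : Set _)
    have h2 : ProjectiveSpectrum.vanishingIdeal ({q} : Set (SpecimenQuarticTcDelta.P3 k)) = q.asHomogeneousIdeal :=
      ProjectiveSpectrum.vanishingIdeal_singleton q
    have h3 : ProjectiveSpectrum.zeroLocus (homogeneousSubmodule (Fin (3 + 1)) k) (q.asHomogeneousIdeal : Set (MvPolynomial (Fin (3 + 1)) k)) =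
        closure {q} := by
      rw [← h2]; exact h1
    rw [← h3]
    exact (ProjectiveSpectrum.zeroLocus_span _ _).symm
  rw [hcl]
  exact isIrreducible_singleton.closure

/-- **`Lᵢ ∖ {P}` is infinite** over an infinite field: the points `(0, 0, t)` of `Spec k[y]` go, under the chart `chartι k 3 i` at `D₊(x_i)`, injectively to
points of the line off the vertex. [folklore] -/
theorem vertexLine_diff_infinite_all [Infinite k] (i : Fin 3) : (vertexLine 2 k i \ {vertex 2 k}).Infinite := by
  refine Set.infinite_of_injective_forall_mem
    ((ProjectiveSpaceCells.chartι k 3 (Fin.castSucc i)).isOpenEmbedding.injective.comp (injective_pointOnAxis k)) fun t => ?_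
  set q : Spec (CommRingCat.of (MvPolynomial (Fin 3) k)) := ⟨RingHom.ker (MvPolynomial.eval (![0, 0, t] : Fin 3 → k)),
    (RingHom.ker_isMaximal_of_surjective (MvPolynomial.eval (![0, 0, t] : Fin 3 → k)) fun a => ⟨C a, eval_C a⟩).isPrime⟩ with hq
  refine ⟨?_, ?_⟩
  · intro j hj
    -- `castSucc j = succAbove (castSucc i) j'` with `j' ∈ {0, 1}` and `y_{j'}` vanishes at `q`
    have hj' : ∃ j' : Fin 3, Fin.succAbove (Fin.castSucc i) j' = Fin.castSucc j ∧ (MvPolynomial.X j' : MvPolynomial (Fin 3) k) ∈ q.asIdeal := by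
      have h0 : (MvPolynomial.X 0 : MvPolynomial (Fin 3) k) ∈ q.asIdeal := by
        change (X 0 : MvPolynomial (Fin 3) k) ∈ RingHom.ker _; rw [RingHom.mem_ker, eval_X]; rfl
      have h1 : (MvPolynomial.X 1 : MvPolynomial (Fin 3) k) ∈ q.asIdeal := by
        change (X 1 : MvPolynomial (Fin 3) k) ∈ RingHom.ker _; rw [RingHom.mem_ker, eval_X]; rfl
      fin_cases i <;> fin_cases j
      all_goals first
        | exact absurd rfl hj
        | exact ⟨0, by decide, h0⟩
        | exact ⟨1, by decide, h1⟩
    obtain ⟨j', hjj', hmem⟩ := hj'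
    have hz : q ∈ PrimeSpectrum.zeroLocus {(MvPolynomial.X j' : MvPolynomial (Fin 3) k)} :=
      (SpecimenQuarticTcDelta.mem_zeroLocus_singleton_iff' q _).mpr hmem
    rw [← ProjectiveSpaceCells.chartι_preimage_zeroLocus_X k 3 (Fin.castSucc i) j'] at hz
    have hz' : (ProjectiveSpaceCells.chartι k 3 (Fin.castSucc i)) q ∈
        ProjectiveSpectrum.zeroLocus (homogeneousSubmodule (Fin (3 + 1)) k)
          {(X (Fin.succAbove (Fin.castSucc i) j') : MvPolynomial (Fin 4) k)} := hz
    rw [hjj'] at hz'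
    exact (ProjectiveSpectrum.mem_zeroLocus _ _ _).mp hz' (Set.mem_singleton _)
  · intro h
    have hr : (ProjectiveSpaceCells.chartι k 3 (Fin.castSucc i)) q ∈ Set.range (ProjectiveSpaceCells.chartι k 3 (Fin.castSucc i)).base :=
      Set.mem_range_self q
    rw [ProjectiveSpaceCells.range_chartι] at hr
    have h' : (ProjectiveSpaceCells.chartι k 3 (Fin.castSucc i)) q = vertex 2 k := h
    rw [h'] at hr
    exact vertex_notMem_basicOpen 2 k i hr

/-- `Lᵢ` is infinite (`k` infinite). [folklore] -/
theorem vertexLine_infinite [Infinite k] (i : Fin 3) : (vertexLine 2 k i).Infinite := (vertexLine_diff_infinite_all k i).mono fun _ hx => hx.1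

/-- **`S` is not a regular scheme** (its point over the triple point is not regular; `S ≅ (range ι)^` over `ℙ³`). [folklore] -/
theorem not_isRegular_hypersurface : ¬ Scheme.IsRegular (hypersurface (form k)).left := by
  intro hreg
  haveI := isIntegral_hypersurface k
  obtain ⟨x, hx⟩ := exists_point_over_vertex k
  obtain ⟨e, -⟩ := ND.exists_iso_subscheme_vanishingIdeal_closure_range (hypersurfaceι (form k)).left
  exact not_isRegularLocalRing_over_vertex k x hx ((ND.isRegularLocalRing_stalk_iff_of_iso' e x).mpr (hreg (e.inv x)))

/-- `ι(S) ⊄ Lᵢ` (the generic point of `S` lies on no line). [folklore] -/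
theorem not_range_subset_vertexLine (i : Fin 3) : ¬ (Set.range (hypersurfaceι (form k)).left ⊆ vertexLine 2 k i) :=
  fun h => pointOfPrime_notMem_vertexLine i (h pointOfPrime_mem_range_ι)

/-- **`dim Lᵢ = 1`** (nose-w4 brick 6: an infinite proper closed subset of the non-regular integral surface `ι(S)`). [folklore] -/
theorem topologicalKrullDim_vertexLine [Infinite k] (i : Fin 3) : topologicalKrullDim (vertexLine 2 k i) = 1 := by
  haveI := isIntegral_hypersurface k
  exact topologicalKrullDim_eq_one_of_three k (hypersurface (form k)).left (hypersurfaceι (form k)).left (not_isRegular_hypersurface k)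
    (isClosed_vertexLine i) (vertexLine_infinite k i) (vertexLine_subset_range_ι i) (not_range_subset_vertexLine k i)

/-- **The curve clause for `L̃ᵢ`** (nose-w4 brick 2). [folklore] -/
theorem curveClause_vertexLine [Infinite k] (i : Fin 3) :
    ∀ z : ↥(redSub (SpecimenQuarticTcDelta.P3 k) (vertexLine 2 k i) (isClosed_vertexLine i)),
      IsClosed ({z} : Set ↥(redSub (SpecimenQuarticTcDelta.P3 k) (vertexLine 2 k i) (isClosed_vertexLine i))) →
      ringKrullDim ((redSub (SpecimenQuarticTcDelta.P3 k) (vertexLine 2 k i) (isClosed_vertexLine i)).presheaf.stalk z) = ((1 : ℕ) : WithBot ℕ∞) := by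
  haveI := isIntegral_hypersurface k
  exact ringKrullDim_stalk_redSub_eq_one k (hypersurface (form k)).left (hypersurfaceι (form k)).left (not_isRegular_hypersurface k)
    (isClosed_vertexLine i) (isIrreducible_vertexLine k i) (vertexLine_infinite k i) (vertexLine_subset_range_ι i) (not_range_subset_vertexLine k i)

end Steiner

namespace Steiner

/-! ## §3 Per line: the strict transform `Z̃ᵢ′` is a regular curve -/

section Blowup

variable {k : Type} [Field k] {F₂ : Scheme.{0}} {υ : F₂ ⟶ SpecimenQuarticTcDelta.P3 k} (hυ : IsBlowup υ (vertexIdealSheaf 2 k))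

/-- The strict-transform line in the COMB/Stacks-080E spelling: `vertexLineStrict υ i = closure υ⁻¹(Lᵢ ∖ V(𝓘{P}))`. [folklore] -/
theorem vertexLineStrict_eq_strictTransform (υ : F₂ ⟶ SpecimenQuarticTcDelta.P3 k) (i : Fin 3) :
    vertexLineStrict υ i = closure (υ ⁻¹' (vertexLine 2 k i \ ((vertexIdealSheaf 2 k).support : Set (SpecimenQuarticTcDelta.P3 k)))) := by
  rw [Scheme.IdealSheafData.coe_support_vanishingIdeal]
  rfl

/-- `Lᵢ ⊄ V(𝓘{P}) = {P}` (the line has other points). [folklore] -/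
theorem not_vertexLine_subset_support [Infinite k] (i : Fin 3) :
    ¬ (vertexLine 2 k i ⊆ ((vertexIdealSheaf 2 k).support : Set (SpecimenQuarticTcDelta.P3 k))) := by
  rw [Scheme.IdealSheafData.coe_support_vanishingIdeal]
  intro h
  obtain ⟨y, hy⟩ := (vertexLine_diff_infinite_all k i).nonempty
  exact hy.2 (h hy.1)

include hυ in
/-- ★ **`Z̃ᵢ′` is REGULAR** — COMB C1 (`CombCentre.isRegular_reducedStrictTransform_of_isRegular_comap`: a blow-up of the regular `L̃ᵢ` in the regular
centre `V(𝓘{P}·𝒪_{L̃ᵢ})`, §1). [cite: Liu2002, Thm. 8.1.19 (a)] -/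
theorem isRegular_redSub_vertexLineStrict [Infinite k] (i : Fin 3) :
    Scheme.IsRegular (redSub F₂ (vertexLineStrict υ i) (isClosed_vertexLineStrict υ i)) := by
  haveI := isNoetherian_P3 (k := k)
  haveI : IsLocallyNoetherian F₂ := isLocallyNoetherian_of_isBlowup_vertex hυ
  haveI : IsProper υ := hυ.isProper
  have h := Theorems.EquisingularLiftNat.CombCentre.isRegular_reducedStrictTransform_of_isRegular_comap (SpecimenQuarticTcDelta.P3 k) F₂ υ
    (vertexIdealSheaf 2 k) hυ (vertexLine 2 k i) (isClosed_vertexLine i) (isIrreducible_vertexLine k i) (not_vertexLine_subset_support i)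
    (isRegular_redSub_vertexLine k i) (isRegular_comap_vanishingIdeal_singleton (isClosed_singleton_vertex 2 k) _)
  exact (isRegular_redSub_congr (vertexLineStrict_eq_strictTransform υ i) (isClosed_vertexLineStrict υ i) isClosed_closure).mpr h

include hυ in
/-- ★ **`Z̃ᵢ′` is a CURVE** (one-dimensional local rings at closed points): `Z̃ᵢ′ ⟶ L̃ᵢ` is a blow-up along the non-zero `𝓘{P}·𝒪_{L̃ᵢ}` (Stacks 080E), hence
proper birational from an integral scheme of dimension `≤ dim L̃ᵢ = 1`, and res-L1-w45b-nose-w4's ✓ `strictTransform_singularCurve_noseData` applies.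
[cite: StacksProject, Tag 080E; Liu2002, §9.2.4 Lemma 2.32] -/
theorem curveClause_redSub_vertexLineStrict [Infinite k] (i : Fin 3) :
    ∀ z : ↥(redSub F₂ (vertexLineStrict υ i) (isClosed_vertexLineStrict υ i)),
      IsClosed ({z} : Set ↥(redSub F₂ (vertexLineStrict υ i) (isClosed_vertexLineStrict υ i))) →
      ringKrullDim ((redSub F₂ (vertexLineStrict υ i) (isClosed_vertexLineStrict υ i)).presheaf.stalk z) = ((1 : ℕ) : WithBot ℕ∞) := by
  haveI := isNoetherian_P3 (k := k)
  haveI : IsLocallyNoetherian F₂ := isLocallyNoetherian_of_isBlowup_vertex hυ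
  haveI : IsProper υ := hυ.isProper
  have hSC := not_vertexLine_subset_support (k := k) i
  obtain ⟨ρ, -, hprop, hρ⟩ := EquisingularLift.StrataSplit.exists_isBlowup_reducedStrictTransform (SpecimenQuarticTcDelta.P3 k) F₂ υ
    (vertexIdealSheaf 2 k) hυ (vertexLine 2 k i) (isClosed_vertexLine i) (isIrreducible_vertexLine k i) hSC
  haveI : IsIntegral (redSub (SpecimenQuarticTcDelta.P3 k) (vertexLine 2 k i) (isClosed_vertexLine i)) :=
    isIntegral_subscheme_vanishingIdeal ⟨vertexLine 2 k i, isClosed_vertexLine i⟩ (isIrreducible_vertexLine k i)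
  haveI : IsIntegral (redSub F₂ (closure (υ ⁻¹' (vertexLine 2 k i \ ((vertexIdealSheaf 2 k).support : Set (SpecimenQuarticTcDelta.P3 k)))))
      isClosed_closure) :=
    Theorems.EquisingularLiftNat.CombCentre.isIntegral_reducedStrictTransform (SpecimenQuarticTcDelta.P3 k) F₂ υ (vertexIdealSheaf 2 k) hυ
      (vertexLine 2 k i) (isClosed_vertexLine i) (isIrreducible_vertexLine k i) hSC
  haveI : IsNoetherian (redSub (SpecimenQuarticTcDelta.P3 k) (vertexLine 2 k i) (isClosed_vertexLine i)) := isNoetherian_subscheme _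
  haveI : IsProper ρ := hprop
  have hbir : IsBirational ρ :=
    hρ.isBirational' (Theorems.EquisingularLiftNat.CombCentre.comap_vanishingIdeal_ne_bot _ _ _ hSC)
  have hinfL : Infinite ↥(redSub (SpecimenQuarticTcDelta.P3 k) (vertexLine 2 k i) (isClosed_vertexLine i)) :=
    infinite_redSub_of_infinite (isClosed_vertexLine i) (vertexLine_infinite k i)
  -- `dim L̃ᵢ = 1`, hence `dim Z̃ᵢ′ ≤ 1`
  have hdimL : topologicalKrullDim ↥(redSub (SpecimenQuarticTcDelta.P3 k) (vertexLine 2 k i) (isClosed_vertexLine i)) ≤ 1 := by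
    have hhom : topologicalKrullDim ↥(redSub (SpecimenQuarticTcDelta.P3 k) (vertexLine 2 k i) (isClosed_vertexLine i)) =
        topologicalKrullDim (Set.range (redSubι (SpecimenQuarticTcDelta.P3 k) (vertexLine 2 k i) (isClosed_vertexLine i))) :=
      IsHomeomorph.topologicalKrullDim_eq _
        (redSubι (SpecimenQuarticTcDelta.P3 k) (vertexLine 2 k i) (isClosed_vertexLine i)).isClosedEmbedding.isEmbedding.toHomeomorph.isHomeomorph
    rw [hhom, range_subschemeι_vanishingIdeal]
    exact le_of_eq (topologicalKrullDim_vertexLine k i)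
  have hdimT := hρ.topologicalKrullDim_le_of_isLocallyNoetherian (n := 1) (by exact_mod_cast hdimL)
  obtain ⟨hZ', -, -, hcurve⟩ := strictTransform_singularCurve_noseData (redSubι F₂ _ isClosed_closure) ρ hbir hinfL (by exact_mod_cast hdimT)
  have hrange : Set.range (redSubι F₂ (closure (υ ⁻¹' (vertexLine 2 k i \ ((vertexIdealSheaf 2 k).support : Set (SpecimenQuarticTcDelta.P3 k)))))
      isClosed_closure) = vertexLineStrict υ i := by
    rw [range_subschemeι_vanishingIdeal, vertexLineStrict_eq_strictTransform]
    rfl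
  exact curveClause_redSub_congr hrange hZ' (isClosed_vertexLineStrict υ i) hcurve

/-! ## §4 The union `Z′ = Z₀′ ⊔ Z₁′ ⊔ Z₂′` and «Steiner ∈ ν2» modulo (c)(d) -/

/-- `Z′` as an iterated union. [folklore] -/
theorem iUnion_vertexLineStrict_eq (υ : F₂ ⟶ SpecimenQuarticTcDelta.P3 k) :
    (⋃ i : Fin 3, vertexLineStrict υ i) = (vertexLineStrict υ 0 ∪ vertexLineStrict υ 1) ∪ vertexLineStrict υ 2 := by
  ext z
  simp only [Set.mem_iUnion, Set.mem_union]
  constructor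
  · rintro ⟨i, h⟩
    fin_cases i
    exacts [Or.inl (Or.inl h), Or.inl (Or.inr h), Or.inr h]
  · rintro ((h | h) | h)
    exacts [⟨0, h⟩, ⟨1, h⟩, ⟨2, h⟩]

include hυ in
/-- ★ **CLAUSE (b), regularity: `Z̃′` is REGULAR** (three pairwise disjoint regular pieces, nose-w3's ✓ `disjoint_vertexLineStrict`, nose-w4's ✓
`isRegular_subscheme_vanishingIdeal_union_of_disjoint`). [OURS · L1 W4.5b · clause (b) of «Steiner ∈ ν2»] -/
theorem isRegular_redSub_iUnion_vertexLineStrict [Infinite k] :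
    Scheme.IsRegular (redSub F₂ (⋃ i : Fin 3, vertexLineStrict υ i) (isClosed_iUnion_vertexLineStrict υ)) := by
  haveI : IsLocallyNoetherian F₂ := isLocallyNoetherian_of_isBlowup_vertex hυ
  have h01 : IsClosed (vertexLineStrict υ 0 ∪ vertexLineStrict υ 1) := (isClosed_vertexLineStrict υ 0).union (isClosed_vertexLineStrict υ 1)
  have h012 : IsClosed ((vertexLineStrict υ 0 ∪ vertexLineStrict υ 1) ∪ vertexLineStrict υ 2) := h01.union (isClosed_vertexLineStrict υ 2)
  have hreg01 := isRegular_subscheme_vanishingIdeal_union_of_disjoint (isClosed_vertexLineStrict υ 0) (isClosed_vertexLineStrict υ 1)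
    (isRegular_redSub_vertexLineStrict hυ 0) (isRegular_redSub_vertexLineStrict hυ 1)
    (Set.disjoint_iff_inter_eq_empty.mp (disjoint_vertexLineStrict hυ (by decide))) h01
  have hdisj : (vertexLineStrict υ 0 ∪ vertexLineStrict υ 1) ∩ vertexLineStrict υ 2 = ∅ :=
    Set.disjoint_iff_inter_eq_empty.mp
      (Disjoint.union_left (disjoint_vertexLineStrict hυ (by decide)) (disjoint_vertexLineStrict hυ (by decide)))
  have hreg := isRegular_subscheme_vanishingIdeal_union_of_disjoint h01 (isClosed_vertexLineStrict υ 2) hreg01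
    (isRegular_redSub_vertexLineStrict hυ 2) hdisj h012
  exact (isRegular_redSub_congr (iUnion_vertexLineStrict_eq υ).symm h012 (isClosed_iUnion_vertexLineStrict υ)).mp hreg

include hυ in
/-- ★ **CLAUSE (b), curve: `Z̃′` has one-dimensional local rings at its closed points** (nose-w3's ✓ `forall_ringKrullDim_stalk_redSub_union` twice).
[OURS · L1 W4.5b · clause (b) of «Steiner ∈ ν2»] -/
theorem curveClause_redSub_iUnion_vertexLineStrict [Infinite k] :
    ∀ z : ↥(redSub F₂ (⋃ i : Fin 3, vertexLineStrict υ i) (isClosed_iUnion_vertexLineStrict υ)),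
      IsClosed ({z} : Set ↥(redSub F₂ (⋃ i : Fin 3, vertexLineStrict υ i) (isClosed_iUnion_vertexLineStrict υ))) →
      ringKrullDim ((redSub F₂ (⋃ i : Fin 3, vertexLineStrict υ i) (isClosed_iUnion_vertexLineStrict υ)).presheaf.stalk z) =
        ((1 : ℕ) : WithBot ℕ∞) := by
  have h01 := NoseCert.forall_ringKrullDim_stalk_redSub_union (isClosed_vertexLineStrict υ 0) (isClosed_vertexLineStrict υ 1)
    (disjoint_vertexLineStrict hυ (by decide)) (curveClause_redSub_vertexLineStrict hυ 0) (curveClause_redSub_vertexLineStrict hυ 1)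
  have h012 := NoseCert.forall_ringKrullDim_stalk_redSub_union ((isClosed_vertexLineStrict υ 0).union (isClosed_vertexLineStrict υ 1))
    (isClosed_vertexLineStrict υ 2)
    (Disjoint.union_left (disjoint_vertexLineStrict hυ (by decide)) (disjoint_vertexLineStrict hυ (by decide))) h01
    (curveClause_redSub_vertexLineStrict hυ 2)
  exact curveClause_redSub_congr (iUnion_vertexLineStrict_eq υ).symm _ (isClosed_iUnion_vertexLineStrict υ) h012

end Blowup

variable (k : Type) [Field k] [IsAlgClosed k]

/-- ★★ **«STEINER ∈ ν2» MODULO (c) AND (d) ONLY.** For `k = k̄`, ANY blowing up `υ : F₂ ⟶ ℙ³` of the triple point and ANY blowing up `υ' : F₃ ⟶ F₂` of the three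
strict-transform lines `Z′`: IF (c) `DirStepUnobs F₂ univ _ Z′` (res-L1-w45b-nose-w3 g2's D3-9 ✓ p658224 per line; the ×3 union call, desk R40) and (d) the reduced
strict transform of `S` after `υ'` is regular ((P5): one blow-up of `Z′` resolves — ring level ✓ p649392), THEN the Roman surface satisfies the 36th registration's
hypothesis `NoseHypPointsFirstBTriplePrime k 3 S ι`. Clauses (a) and (b) are now tree theorems (✓ `iUnion_vertexLineStrict_infinite`, §4 above).
[OURS · L1 W4.5b · «Steiner ∈ ν2» assembled modulo (c)(d)] -/
theorem noseHypPointsFirstBTriplePrime_of_unobs_of_final {F₂ : Scheme.{0}} {υ : F₂ ⟶ SpecimenQuarticTcDelta.P3 k}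
    (hυ : IsBlowup υ (vertexIdealSheaf 2 k))
    (hunobs : DirStepUnobs F₂ Set.univ isClosed_univ (⋃ i : Fin 3, vertexLineStrict υ i) (isClosed_iUnion_vertexLineStrict υ))
    {F₃ : Scheme.{0}} {υ' : F₃ ⟶ F₂}
    (hυ' : IsBlowup υ' (vanishingIdeal (⟨⋃ i : Fin 3, vertexLineStrict υ i, isClosed_iUnion_vertexLineStrict υ⟩ : Closeds F₂)))
    (hfin : Scheme.IsRegular (vanishingIdeal (⟨closure (υ' ⁻¹'
      (closure (υ ⁻¹' (Set.range (hypersurfaceι (form k)).left \ {vertex 2 k})) \ ⋃ i : Fin 3, vertexLineStrict υ i)),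
        isClosed_closure⟩ : Closeds F₃)).subscheme) :
    NoseHypPointsFirstBTriplePrime k 3 (hypersurface (form k)).left (hypersurfaceι (form k)).left := by
  haveI : Infinite k := IsAlgClosed.instInfinite
  exact noseHypPointsFirstBTriplePrime_of_clauses' k hυ (curveClause_redSub_iUnion_vertexLineStrict hυ)
    (isRegular_redSub_iUnion_vertexLineStrict hυ) hunobs hυ' hfin

end Steiner

end Summit.ResolutionOfSingularities.ResolutionOfSingularities.Cruxes.EquisingularLiftNat.Sections

end
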